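import Summits.QuantumFields.QCD.Theses.NestedDissectionSea
import Summits.QuantumFields.QCD.Theorems.NestedDissectionSeaDiluteOfCoercive

/-!
# Route `NestedDissectionSea`, support `CoerciveOfDilute` (stmt-QuantumFields-14759) — its logical position

`CoerciveOfDilute := NegativeCellsDilute → CoerciveSea` is glue between the tier-deciding crux
(stmt-QuantumFields-13900) and the hinge (stmt-QuantumFields-13901). With the landed projection
`DiluteOfCoercive : CoerciveSea → NegativeCellsDilute` (`diluteOfCoercive_proof`, stmt-11276) its
position among the route's items is pinned down by pure logic, recorded here sorry-free so that the
ledger relation is kernel-visible: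

* `coerciveOfDilute_iff_coerciveSea_or_not_dilute` — the item holds iff the hinge holds or the
  tier-deciding crux fails: it CLOSES exactly when stmt-13901 is proved or stmt-13900 is refuted;
* `coerciveOfDilute_of_not_negativeCellsDilute` — the second closing path, as an implication;
* `coerciveSea_iff_negativeCellsDilute_and_coerciveOfDilute` — closing 13900 and 14759 is the same
  work as closing 13901 (the hinge is the conjunction of its projection and its glue).

The mathematical content of a direct proof (clause (i) of `CoerciveSea`, the separator Wegner law,
along the dilution-certified regularisation) and every `∃`-freedom it enjoys are typed in
`NestedDissectionSeaCoerciveOfDilute{,Subseq,Leaf,LargeLeaf,TwoLaws}.lean`. Standard material. [folklore]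
-/

open Summit.QuantumFields.QCD.Theses.NestedDissectionSea

namespace Summit.QuantumFields.QCD.Theorems.NestedDissectionSeaCoerciveOfDilute

/-- **`CoerciveOfDilute ↔ (CoerciveSea ∨ ¬ NegativeCellsDilute)`**: the glue item closes exactly when
the hinge (stmt-QuantumFields-13901) is proved or the tier-deciding crux (stmt-QuantumFields-13900) is
refuted (classical `A → B ↔ B ∨ ¬A`). [folklore] -/
theorem coerciveOfDilute_iff_coerciveSea_or_not_dilute :
    CoerciveOfDilute ↔ (CoerciveSea ∨ ¬ NegativeCellsDilute) := by
  unfold CoerciveOfDilute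
  constructor
  · intro h
    by_cases hD : NegativeCellsDilute
    · exact Or.inl (h hD)
    · exact Or.inr hD
  · rintro (h | h) hD
    · exact h
    · exact absurd hD h

/-- **A refutation of `NegativeCellsDilute` closes the glue item** (ex falso). [folklore] -/
theorem coerciveOfDilute_of_not_negativeCellsDilute (h : ¬ NegativeCellsDilute) : CoerciveOfDilute :=
  fun hD => absurd hD h

/-- **`CoerciveSea ↔ NegativeCellsDilute ∧ CoerciveOfDilute`**: the hinge is the conjunction of its
projection (the landed `diluteOfCoercive_proof : DiluteOfCoercive`, stmt-QuantumFields-11276) and its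
glue; so closing stmt-13900 together with stmt-14759 is closing stmt-13901. [folklore] -/
theorem coerciveSea_iff_negativeCellsDilute_and_coerciveOfDilute :
    CoerciveSea ↔ (NegativeCellsDilute ∧ CoerciveOfDilute) :=
  ⟨fun h => ⟨Summit.QuantumFields.QCD.Theorems.diluteOfCoercive_proof h, fun _ => h⟩,
    fun h => h.2 h.1⟩

end Summit.QuantumFields.QCD.Theorems.NestedDissectionSeaCoerciveOfDilute
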